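import Summits.HodgeConjecture.HodgeConjecture.Theorems.HeckePrymWeilHeckePrymAnchorsOfStubs
import Summits.HodgeConjecture.HodgeConjecture.Theorems.HeckePrymWeilHeckePrymAnchorsUpgrade
import Summits.HodgeConjecture.HodgeConjecture.Theorems.HeckePrymWeilHeckePrymAnchorsRationalAlongSection
import Summits.HodgeConjecture.HodgeConjecture.Theorems.HeckePrymWeilHeckePrymAnchorsGlobalClassOfLeray
import Summits.HodgeConjecture.HodgeConjecture.Theses.AnchorTransport
import Literature.AlgebraicGeometry.HodgeTheory.InvariantClassesFromTotalSpace
import Literature.AlgebraicGeometry.HodgeTheory.WeilFamilyFlatSections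
import HarnessLib

/-!
# `WeilTenfoldsSqrtMinus11` modulo two named facts and the transport step (item stmt-HodgeConjecture-1262, route HeckePrymWeil)

Line `quaternionic-norm-anchors` of crux `HeckePrymWeil.WeilTenfoldsSqrtMinus11` (the Hodge–Weil classes
of every complex abelian TENFOLD `A` with `φ ≫ φ = -11`, field `K = ℚ(√-11)`, type `(5,5)`), skeleton v2
("tensor-anchor reshape", lead c2, 2026-08-16), stub `stub_ofTwoFactsOfWeilVariationalHodge`: the
ENGINE-AGNOSTIC RESIDUE of the crux. This is the `(p, k) = (11, 5)` instance of the sibling crux's landed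
`Theorems/HeckePrymWeilHyperbolicEightfoldsSqrtMinus7OfWeilFamily.lean` (stmt-HodgeConjecture-14642,
`(p, k) = (7, 4)`), composed from the same tree declarations:

* the accepted named fact `HodgeTheory.deligne1982_weilFamily_hodgeWeilSection` (Deligne, LNM 900, proof
  of Thm. 4.8 with Prop. 4.4; van Geemen LNM 1594 §5; André 1996 Lemme 6.3.3): through EVERY `√-p`-abelian
  `2k`-fold `(X, Φ)` and every non-zero rational `(k,k)` class `c` of its strong Weil plane there is an
  embedded smooth projective family over a smooth irreducible quasi-projective base with a continuous,
  fibrewise Hodge, Weil section `σ` through `c` and a fibre `K`-isogenous to a TENSOR POINT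
  `(A₁ × A₁, companion)`, at which the strong Weil plane is algebraic by Deligne's Lemma 4.5 / Remark 4.10
  — PROVED in the tree (`HeckePrymWeilLine.owf_anchorAlgebraic` = `stub_pointClassAnchor` across
  `stub_isogenyTransfer`);
* the proved typing upgrade `HeckePrymWeilLine.stub_upgrade` (the crux's single-operator plane
  `Eig((𝟙+φ)^*, (1±i√11)¹⁰)` lies in `weilClassesOf A φ 5 11`), the proved rationality along continuous
  sections `stub_rationalAlongSection`, the W-engine `stub_globalClassOfSection_of_leray` (the accepted
  named fact `deligne1968_invariantClass_fromTotalSpace`, Deligne 1968 at one point, + the identity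
  principle) and the route's proved `IsoInvariance` (`Theorems.isoInvariance_proof`).

Contents:

* `weilTenfolds_of_engine_of_weilFamily_of_transport` — the COMPOSITION from three hypotheses spelled
  out / named, concluding the crux BY NAME: the W-engine `hG`, the Weil-family fact `hWF` BY NAME, and
  `hT` = TENSOR-ANCHORED WEIL TRANSPORT IN DIMENSION 10: along an embedded smooth projective family of
  `√-11`-tenfolds over a smooth irreducible quasi-projective base, a global class that is fibrewise
  rational of type `(5,5)` and algebraic at a fibre `K`-isogenous to a tensor point (where it lies in the
  strong Weil plane) is algebraic on every fibre (the shape of [Markman2025SecantWeil, Thm. 1.5.1] in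
  dimension 6; OPEN in dimension 10, [Markman2025SecantWeil, §1.2]);
* `tensorTransport10_of_weilVariationalHodge`, `tensorTransport10_of_anchorTransport` — `hT` is an
  instance of the route crux `WeilVariationalHodge` (stmt-HodgeConjecture-14497) at `(p, M) = (11, 5)` and
  of `AnchorTransport.VariationalHodge` (stmt-HodgeConjecture-1076) at `p = 5`;
* `stub_ofTwoFactsOfWeilVariationalHodge` — the REGISTERED stub: the crux from THREE EXISTING
  DECLARATIONS of the tree and nothing else: the accepted named facts
  `deligne1968_invariantClass_fromTotalSpace`, `deligne1982_weilFamily_hodgeWeilSection` and the route crux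
  `WeilVariationalHodge`; likewise `weilTenfoldsSqrtMinus11_of_two_facts_of_anchorTransport`.

CONDITIONAL results (trust base: the two named facts, plus the route crux taken as hypothesis); no
definition, no `sorry`. Deliberately NOT here: the Perry-engine composition of the line
(`stub_perryRouteComposition`, file `…TensorAnchorPerry`) and the continuity of scalar multiples of
sections (`HeckePrymWeil.TensorAnchor.stub_sectionSmul`).
-/

noncomputable section

-- single-problem summit (Problem = Summit): the mandated namespace repeats `HodgeConjecture`.
set_option linter.dupNamespace false

open CategoryTheory AlgebraicGeometry Limits MonoidalCategory CartesianMonoidalCategory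
open Literature.AlgebraicGeometry Literature.AlgebraicGeometry.Motives
  Literature.AlgebraicGeometry.HodgeTheory
open Summit.HodgeConjecture.HodgeConjecture.Theorems.HeckePrymWeilLine
  (stub_upgrade stub_rationalAlongSection stub_globalClassOfSection_of_leray owf_isoTransport
    owf_anchorAlgebraic)

namespace Summit.HodgeConjecture.HodgeConjecture.Theorems.WeilTenfoldsSqrtMinus11.TensorAnchor

/-- **`WeilTenfoldsSqrtMinus11` from the W-engine, Deligne's Weil family and tensor-anchored transport**
(every rational `(5,5)` class of the typed Weil plane of ANY complex abelian tenfold `A` with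
`φ ≫ φ = -11` is algebraic; the crux has no idle hypotheses and is concluded BY NAME). `hG`: every
continuous section of `FiberClass f k → S(ℂ)` of an embedded smooth projective family over a smooth
quasi-projective irreducible base is the global section of one class of the open total space. `hWF`:
the named fact `deligne1982_weilFamily_hodgeWeilSection`. `hT`: tensor-anchored Weil transport in
dimension 10 (module docstring). Proof: `c = 0` is algebraic; otherwise upgrade `c` to the strong Weil
plane (`stub_upgrade` at `(11, 5)`), take the Weil family `f : 𝒳 → S` through `A` with its continuous
fibrewise-Hodge section `σ` through `c` and its tensor-isogenous fibre `Y ≅ 𝒳_{s₀}` (`hWF` at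
`(p, k) = (11, 5)`), globalise `σ` to one class `W` (`hG`), read rationality of `W|_{𝒳_s}` from
`stub_rationalAlongSection` and Hodge type from the family, algebraicity of `W|_{𝒳_{s₀}}` from
`owf_anchorAlgebraic` through `owf_isoTransport`, transport it to `s₁` (`hT`), and pull back along
`e : A ≅ 𝒳_{s₁}` (`IsoInvariance`). The `(11,5)` instance of the sibling's
`HyperbolicEightfoldsSqrtMinus7.TensorAnchor.weilEightfolds_of_engine_of_weilFamily_of_transport`.
[cite: Deligne1982HodgeCycles, proof of Thm. 4.8 (pp. 47–52), Prop. 4.4, Lemma 4.5, Remark 4.10]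
[cite: vanGeemen1994HodgeAV, §5.3–5.11] [cite: Andre1996Motifs, Lemme 6.3.3]
[cite: Markman2025SecantWeil, Thm. 1.5.1 and §1.2] -/
theorem weilTenfolds_of_engine_of_weilFamily_of_transport
    (hG : ∀ ⦃𝒳 S : SchemeOver ℂ⦄ (f : 𝒳 ⟶ S) (n k : ℕ), IsSmoothProjectiveFamily f n →
      (∃ (N : ℕ) (ι : 𝒳 ⟶ projectiveSpace N ℂ ⊗ S),
          IsClosedImmersion ι.left ∧ ι ≫ snd (projectiveSpace N ℂ) S = f) →
      AlgebraicGeometry.Smooth S.hom → IsQuasiProjectiveOver S → IrreducibleSpace S.left →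
      ∀ (σ : ComplexPoints S → FiberClass f k), Continuous σ → (∀ s, (σ s).pt = s) →
        ∃ W : complexBetti 𝒳 k, ∀ s, σ s = globalSection f k W s)
    (hWF : deligne1982_weilFamily_hodgeWeilSection)
    (hT : ∀ ⦃𝒳 S : SchemeOver ℂ⦄ (f : 𝒳 ⟶ S), IsSmoothProjectiveFamily f 10 →
      (∃ (N : ℕ) (ι : 𝒳 ⟶ projectiveSpace N ℂ ⊗ S),
          IsClosedImmersion ι.left ∧ ι ≫ snd (projectiveSpace N ℂ) S = f) →
      IrreducibleSpace S.left → AlgebraicGeometry.Smooth S.hom → IsQuasiProjectiveOver S →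
      ∀ (W : complexBetti 𝒳 10),
        (∀ s : ComplexPoints S, IsRationalClass (complexBetti.map (fiberι f s) 10 W) ∧
          IsOfHodgeType 10 (fiberOver f s) 10 5 5 (complexBetti.map (fiberι f s) 10 W)) →
        (∀ s : ComplexPoints S, ∃ (A' : AbelianVariety ℂ) (φ' : A' ⟶ A'),
          A'.dim = 10 ∧ φ' ≫ φ' = -((11 : ℤ) • 𝟙 A') ∧ Nonempty (A'.X ≅ fiberOver f s)) →
        ∀ s₀ : ComplexPoints S,
          (∃ (Y : AbelianVariety ℂ) (Ψ : Y ⟶ Y) (e₀ : Y.X ≅ fiberOver f s₀) (A₁ : AbelianVariety ℂ)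
              (f₁ : Y ⟶ A₁.prod A₁) (g₁ : A₁.prod A₁ ⟶ Y) (m : ℕ),
            A₁.dim = 5 ∧ Y.dim = 10 ∧ Ψ ≫ Ψ = -((11 : ℤ) • 𝟙 Y) ∧ 0 < m ∧ f₁ ≫ g₁ = m • 𝟙 Y ∧
              Flat f₁.hom.hom.hom.left ∧
              g₁ ≫ Ψ = AbelianVariety.prodLift (AbelianVariety.snd A₁ A₁ ≫ (-((11 : ℤ) • 𝟙 A₁)))
                (AbelianVariety.fst A₁ A₁) ≫ g₁ ∧
              complexBetti.map e₀.hom 10 (complexBetti.map (fiberι f s₀) 10 W) ∈ weilClassesOf Y Ψ 5 11) →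
          complexBetti.map (fiberι f s₀) 10 W ∈ algebraicClasses (fiberOver f s₀) 5 →
          ∀ s : ComplexPoints S, complexBetti.map (fiberι f s) 10 W ∈ algebraicClasses (fiberOver f s) 5) :
    Summit.HodgeConjecture.HodgeConjecture.Theses.HeckePrymWeil.WeilTenfoldsSqrtMinus11 := by
  intro A φ hA hφ c hr hH hW
  by_cases hc : c = 0
  · rw [hc]
    exact Submodule.zero_mem _
  -- casts: the named facts are stated for a variable prime `p`, here `p = 11`, and at degree `2 * 5`
  have hφ' : φ ≫ φ = -(((11 : ℕ) : ℤ) • 𝟙 A) := by exact_mod_cast hφ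
  have hA' : A.dim = 2 * 5 := hA
  -- typing upgrade: the single-operator plane lies in the strong Weil plane
  have hcW : c ∈ weilClassesOf A φ 5 11 := by
    refine stub_upgrade 11 (by norm_num) (by norm_num) (by norm_num) 5 A φ hA' hφ' ?_
    exact_mod_cast hW
  -- Deligne's Weil family through `A`, continuous fibrewise-Hodge Weil section through `c`, tensor fibre
  obtain ⟨𝒳, S, f, s₁, s₀, e, σ, hfam, hι, hirr, hsm, hSqp, hfib, hσ, hpt, hHσ, hs₁, Y, Ψ, e₀, x,
    ⟨A₁, f₁, g₁, m, hA₁, hY, hΨ, hm, hfg, hf, hg⟩, hs₀, hx⟩ :=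
    hWF 11 (by norm_num) (by norm_num) (by norm_num) 5 (by norm_num) A φ hA' hφ' c hcW hc hr hH
  -- the global class of the section (W-engine)
  obtain ⟨W, hWσ⟩ := hG f (2 * 5) (2 * 5) hfam hι hsm hSqp hirr σ hσ hpt
  have hcls : ∀ (s : ComplexPoints S) (y : complexBetti (fiberOver f s) (2 * 5)),
      σ s = ⟨s, y⟩ → complexBetti.map (fiberι f s) (2 * 5) W = y := by
    intro s y hy
    have h := (hWσ s).symm.trans hy
    simp only [globalSection, FiberClass.mk.injEq, heq_eq_eq, true_and] at h
    exact h
  have hW₁ : complexBetti.map (fiberι f s₁) (2 * 5) W = complexBetti.map e.inv (2 * 5) c :=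
    hcls s₁ _ hs₁
  have hW₀ : complexBetti.map (fiberι f s₀) (2 * 5) W = x := hcls s₀ x hs₀
  -- rationality along the section (proved), Hodge type from the family's clause (a)
  have hrat₁ : IsRationalClass (σ s₁).cls := by
    rw [hs₁]; exact hr.map _
  have hratσ : ∀ s, IsRationalClass (σ s).cls :=
    stub_rationalAlongSection f (2 * 5) (2 * 5) hfam hsm hSqp hirr σ hσ hpt s₁ hrat₁
  have hfibre : ∀ s : ComplexPoints S,
      IsRationalClass (complexBetti.map (fiberι f s) (2 * 5) W) ∧
      IsOfHodgeType (2 * 5) (fiberOver f s) (2 * 5) 5 5 (complexBetti.map (fiberι f s) (2 * 5) W) := by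
    intro s
    have h₁ := hratσ s
    have h₂ := hHσ s
    rw [hWσ s] at h₁ h₂
    exact ⟨h₁, h₂⟩
  -- every fibre is a `√-11`-tenfold
  have hfib' : ∀ s : ComplexPoints S, ∃ (A' : AbelianVariety ℂ) (φ' : A' ⟶ A'),
      A'.dim = 10 ∧ φ' ≫ φ' = -((11 : ℤ) • 𝟙 A') ∧ Nonempty (A'.X ≅ fiberOver f s) := by
    intro s
    obtain ⟨A', φ', h1, h2, h3⟩ := hfib s
    exact ⟨A', φ', h1, by exact_mod_cast h2, h3⟩
  -- the anchor: the strong Weil plane of the tensor-isogenous fibre is algebraic (Deligne 4.5 / 4.10)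
  have h0 : complexBetti.map (fiberι f s₀) (2 * 5) W ∈ algebraicClasses (fiberOver f s₀) 5 := by
    rw [hW₀]
    exact owf_isoTransport _ Y e₀ 5 x
      (owf_anchorAlgebraic (by norm_num) (by norm_num) (by norm_num) A₁ f₁ g₁ m hA₁ hY hΨ hm hfg hf hg
        hx)
  -- transport from the anchor fibre to `s₁`
  have hanchor : ∃ (Y : AbelianVariety ℂ) (Ψ : Y ⟶ Y) (e₀ : Y.X ≅ fiberOver f s₀)
      (A₁ : AbelianVariety ℂ) (f₁ : Y ⟶ A₁.prod A₁) (g₁ : A₁.prod A₁ ⟶ Y) (m : ℕ),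
      A₁.dim = 5 ∧ Y.dim = 10 ∧ Ψ ≫ Ψ = -((11 : ℤ) • 𝟙 Y) ∧ 0 < m ∧ f₁ ≫ g₁ = m • 𝟙 Y ∧
        Flat f₁.hom.hom.hom.left ∧
        g₁ ≫ Ψ = AbelianVariety.prodLift (AbelianVariety.snd A₁ A₁ ≫ (-((11 : ℤ) • 𝟙 A₁)))
          (AbelianVariety.fst A₁ A₁) ≫ g₁ ∧
        complexBetti.map e₀.hom 10 (complexBetti.map (fiberι f s₀) 10 W) ∈ weilClassesOf Y Ψ 5 11 := by
    refine ⟨Y, Ψ, e₀, A₁, f₁, g₁, m, hA₁, hY, by exact_mod_cast hΨ, hm, hfg, hf, by exact_mod_cast hg,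
      ?_⟩
    have hx' : complexBetti.map e₀.hom (2 * 5) (complexBetti.map (fiberι f s₀) (2 * 5) W) ∈
        weilClassesOf Y Ψ 5 11 := by
      rw [hW₀]; exact hx
    exact hx'
  have h1 : complexBetti.map (fiberι f s₁) (2 * 5) W ∈ algebraicClasses (fiberOver f s₁) 5 :=
    hT f hfam hι hirr hsm hSqp W hfibre hfib' s₀ hanchor h0 s₁
  -- back along `e : A ≅ 𝒳_{s₁}` (the route's proved `IsoInvariance`)
  have key := Theorems.isoInvariance_proof e 5 _ h1
  rw [hW₁, ← CategoryTheory.comp_apply, ← complexBetti.map_comp, Iso.hom_inv_id,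
    complexBetti.map_id] at key
  exact key

/-- **Tensor-anchored Weil transport in dimension 10 is an instance of the route crux
`WeilVariationalHodge`** (stmt-HodgeConjecture-14497) at `(p, M) = (11, 5)`: forget the embedding, the
quasi-projectivity and the anchor. [cite: Deligne1982HodgeCycles, proof of Thm. 4.8 (pp. 47–52)]
[cite: Markman2025SecantWeil, §1.2] -/
theorem tensorTransport10_of_weilVariationalHodge
    (hV : Summit.HodgeConjecture.HodgeConjecture.Theses.HeckePrymWeil.WeilVariationalHodge) :
    ∀ ⦃𝒳 S : SchemeOver ℂ⦄ (f : 𝒳 ⟶ S), IsSmoothProjectiveFamily f 10 →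
      (∃ (N : ℕ) (ι : 𝒳 ⟶ projectiveSpace N ℂ ⊗ S),
          IsClosedImmersion ι.left ∧ ι ≫ snd (projectiveSpace N ℂ) S = f) →
      IrreducibleSpace S.left → AlgebraicGeometry.Smooth S.hom → IsQuasiProjectiveOver S →
      ∀ (W : complexBetti 𝒳 10),
        (∀ s : ComplexPoints S, IsRationalClass (complexBetti.map (fiberι f s) 10 W) ∧
          IsOfHodgeType 10 (fiberOver f s) 10 5 5 (complexBetti.map (fiberι f s) 10 W)) →
        (∀ s : ComplexPoints S, ∃ (A' : AbelianVariety ℂ) (φ' : A' ⟶ A'),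
          A'.dim = 10 ∧ φ' ≫ φ' = -((11 : ℤ) • 𝟙 A') ∧ Nonempty (A'.X ≅ fiberOver f s)) →
        ∀ s₀ : ComplexPoints S,
          (∃ (Y : AbelianVariety ℂ) (Ψ : Y ⟶ Y) (e₀ : Y.X ≅ fiberOver f s₀) (A₁ : AbelianVariety ℂ)
              (f₁ : Y ⟶ A₁.prod A₁) (g₁ : A₁.prod A₁ ⟶ Y) (m : ℕ),
            A₁.dim = 5 ∧ Y.dim = 10 ∧ Ψ ≫ Ψ = -((11 : ℤ) • 𝟙 Y) ∧ 0 < m ∧ f₁ ≫ g₁ = m • 𝟙 Y ∧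
              Flat f₁.hom.hom.hom.left ∧
              g₁ ≫ Ψ = AbelianVariety.prodLift (AbelianVariety.snd A₁ A₁ ≫ (-((11 : ℤ) • 𝟙 A₁)))
                (AbelianVariety.fst A₁ A₁) ≫ g₁ ∧
              complexBetti.map e₀.hom 10 (complexBetti.map (fiberι f s₀) 10 W) ∈ weilClassesOf Y Ψ 5 11) →
          complexBetti.map (fiberι f s₀) 10 W ∈ algebraicClasses (fiberOver f s₀) 5 →
          ∀ s : ComplexPoints S, complexBetti.map (fiberι f s) 10 W ∈ algebraicClasses (fiberOver f s) 5 := by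
  intro 𝒳 S f hf _ hirr hsm _ W hall hfib s₀ _ h0 s
  exact hV 11 (by norm_num) (by norm_num) (by norm_num) 5 (by norm_num) f hf hirr hsm W hall
    (fun s' => by
      obtain ⟨A', φ', h1, h2, h3⟩ := hfib s'
      exact ⟨A', φ', h1, by exact_mod_cast h2, h3⟩)
    ⟨s₀, h0⟩ s

/-- **Tensor-anchored Weil transport in dimension 10 is an instance of `AnchorTransport.VariationalHodge`**
(route AnchorTransport, stmt-HodgeConjecture-1076, the shared transport engine) at `p = 5`: forget the
embedding, the quasi-projectivity, the Weil structure of the fibres and the anchor.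
[cite: Deligne1982HodgeCycles, proof of Thm. 4.8 (pp. 47–52)] [cite: Markman2025SecantWeil, §1.2] -/
theorem tensorTransport10_of_anchorTransport
    (hV : Summit.HodgeConjecture.HodgeConjecture.Theses.AnchorTransport.VariationalHodge) :
    ∀ ⦃𝒳 S : SchemeOver ℂ⦄ (f : 𝒳 ⟶ S), IsSmoothProjectiveFamily f 10 →
      (∃ (N : ℕ) (ι : 𝒳 ⟶ projectiveSpace N ℂ ⊗ S),
          IsClosedImmersion ι.left ∧ ι ≫ snd (projectiveSpace N ℂ) S = f) →
      IrreducibleSpace S.left → AlgebraicGeometry.Smooth S.hom → IsQuasiProjectiveOver S →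
      ∀ (W : complexBetti 𝒳 10),
        (∀ s : ComplexPoints S, IsRationalClass (complexBetti.map (fiberι f s) 10 W) ∧
          IsOfHodgeType 10 (fiberOver f s) 10 5 5 (complexBetti.map (fiberι f s) 10 W)) →
        (∀ s : ComplexPoints S, ∃ (A' : AbelianVariety ℂ) (φ' : A' ⟶ A'),
          A'.dim = 10 ∧ φ' ≫ φ' = -((11 : ℤ) • 𝟙 A') ∧ Nonempty (A'.X ≅ fiberOver f s)) →
        ∀ s₀ : ComplexPoints S,
          (∃ (Y : AbelianVariety ℂ) (Ψ : Y ⟶ Y) (e₀ : Y.X ≅ fiberOver f s₀) (A₁ : AbelianVariety ℂ)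
              (f₁ : Y ⟶ A₁.prod A₁) (g₁ : A₁.prod A₁ ⟶ Y) (m : ℕ),
            A₁.dim = 5 ∧ Y.dim = 10 ∧ Ψ ≫ Ψ = -((11 : ℤ) • 𝟙 Y) ∧ 0 < m ∧ f₁ ≫ g₁ = m • 𝟙 Y ∧
              Flat f₁.hom.hom.hom.left ∧
              g₁ ≫ Ψ = AbelianVariety.prodLift (AbelianVariety.snd A₁ A₁ ≫ (-((11 : ℤ) • 𝟙 A₁)))
                (AbelianVariety.fst A₁ A₁) ≫ g₁ ∧
              complexBetti.map e₀.hom 10 (complexBetti.map (fiberι f s₀) 10 W) ∈ weilClassesOf Y Ψ 5 11) →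
          complexBetti.map (fiberι f s₀) 10 W ∈ algebraicClasses (fiberOver f s₀) 5 →
          ∀ s : ComplexPoints S, complexBetti.map (fiberι f s) 10 W ∈ algebraicClasses (fiberOver f s) 5 := by
  intro 𝒳 S f hf _ hirr hsm _ W hall _ s₀ _ h0 s
  exact hV f hf hirr hsm 5 W hall ⟨s₀, h0⟩ s

/-- **Stub `stub_ofTwoFactsOfWeilVariationalHodge` (registered; the engine-agnostic residue of the crux):
`WeilTenfoldsSqrtMinus11` from three existing declarations of the tree** — the accepted named facts
`deligne1968_invariantClass_fromTotalSpace` (Deligne 1968 / Voisin II Thm. 4.18),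
`deligne1982_weilFamily_hodgeWeilSection` (Deligne LNM 900, proof of Thm. 4.8) and the route crux
`WeilVariationalHodge` (stmt-HodgeConjecture-14497, OPEN) at `(11, 5)`. CONDITIONAL on exactly these: the
crux is CLOSED MODULO two accepted named facts and the route's own uniform transport crux.
[cite: Deligne1968, Prop. (2.1) with (2.6.3)] [cite: VoisinHodgeII2003, Thm. 4.18]
[cite: Deligne1982HodgeCycles, proof of Thm. 4.8 (pp. 47–52) with Prop. 4.4, Lemma 4.5, Remark 4.10] -/
theorem stub_ofTwoFactsOfWeilVariationalHodge : deligne1968_invariantClass_fromTotalSpace → deligne1982_weilFamily_hodgeWeilSection → Summit.HodgeConjecture.HodgeConjecture.Theses.HeckePrymWeil.WeilVariationalHodge → Summit.HodgeConjecture.HodgeConjecture.Theses.HeckePrymWeil.WeilTenfoldsSqrtMinus11 :=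
  fun hL hWF hV => weilTenfolds_of_engine_of_weilFamily_of_transport
    (stub_globalClassOfSection_of_leray hL) hWF (tensorTransport10_of_weilVariationalHodge hV)

/-- **`WeilTenfoldsSqrtMinus11` from the two named facts and `AnchorTransport.VariationalHodge`**
(stmt-HodgeConjecture-1076, the shared transport engine, OPEN). CONDITIONAL on exactly these.
[cite: Deligne1968, Prop. (2.1) with (2.6.3)] [cite: Deligne1982HodgeCycles, proof of Thm. 4.8 (pp. 47–52)] -/
theorem weilTenfoldsSqrtMinus11_of_two_facts_of_anchorTransport
    (hL : deligne1968_invariantClass_fromTotalSpace) (hWF : deligne1982_weilFamily_hodgeWeilSection)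
    (hV : Summit.HodgeConjecture.HodgeConjecture.Theses.AnchorTransport.VariationalHodge) :
    Summit.HodgeConjecture.HodgeConjecture.Theses.HeckePrymWeil.WeilTenfoldsSqrtMinus11 :=
  weilTenfolds_of_engine_of_weilFamily_of_transport
    (stub_globalClassOfSection_of_leray hL) hWF (tensorTransport10_of_anchorTransport hV)

end Summit.HodgeConjecture.HodgeConjecture.Theorems.WeilTenfoldsSqrtMinus11.TensorAnchor

end
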